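import Literature.AnabelianGeometry.SemiGraphs.TemperedPiTreesTrans
import Literature.AlgebraicGeometry.Frobenioids.QuasiTemperoidInductionFunctor
import HarnessLib

/-!
# Decomposition homomorphisms `Π_v → π₁^temp(𝒢)` along a Galois tower ([SemiAnbd] §3 pp. 38, 40–41)

Mochizuki, *Semi-graphs of anabelioids*, Publ. RIMS **42** (2006), §3: Thm. 3.7 (i), author's manuscript
p. 40 [cite: MochizukiSemiAnbd2006, Thm 3.7(i) p.40] ("there is a natural continuous, injective outer
homomorphism `π̂₁(𝒢_v) ↪ π₁^temp(𝒢)` … the verticial subgroups") and the proof of Thm. 3.7 (iii), p. 41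
[cite: MochizukiSemiAnbd2006, Thm 3.7(iii) p.41] ("a compatible system of vertices of `𝒢_{∞,j}` …
each of which is fixed by `H`"), for the tower `π₁^temp(𝒢) = lim_n Gal(𝒢_{∞,S n}/𝒢)` of p. 38.

For Galois level data `D` (abc-iut-L3-t9, `TemperedPiSystem.lean`) this file constructs, from a
COMPATIBLE SEQUENCE OF POINTS `t n` of the fibres over a vertex `v` of the coverings
`𝒢_{∞,n} = D.cover n` (compatible under the covering maps `D.stepCover n : 𝒢_{∞,n+1} → 𝒢_{∞,n}`),
the DECOMPOSITION HOMOMORPHISM `decompHom : Π_v →* π₁^temp(𝒢)`: `h ↦ (σ_n)_n`, `σ_n` the unique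
automorphism of `𝒢_{∞,n}` moving `t n` to `h⁻¹ · t n` (existence: transitivity of `Aut(𝒢_{∞,n})` on
fibres, `exists_aut_apply_eq'`; uniqueness: rigidity `univCoverOver_hom_ext`; compatibility with
`step`: the square `σ ≫ stepCover = stepCover ≫ step σ`).  It is a continuous homomorphism
(`decompHomCont`) whose image FIXES the compatible vertex system `x n = [t n]` of the trees `𝔾̃_n`
(`treeAct_decompHom_vertexMap`: the tree half of the identification (I1) of `TemperedLevelData.lean`).
The converse containment (the stabiliser of `x` lies in the image, tree half of (I2)) and the
existence of compatible point sequences over a compatible vertex system are in the sequel.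

Seat abc-iut-L3-t6 (row «DECOMP»). Nothing here bears on [IUTchIII] Cor. 3.12.
-/

namespace Literature.AnabelianGeometry.SemiGraphs

namespace ProfiniteSemiGraph

namespace GaloisLevelData

open CategoryTheory Topology
open Literature.AlgebraicGeometry.Frobenioids.QuasiTemperoid (stabilizerSubgroup
  mem_stabilizerSubgroup_iff isOpen_stabilizerSubgroup)
open Literature.AlgebraicGeometry.Frobenioids.QuasiTemperoid.BTempConnected (ρ_one_apply
  ρ_mul_apply ρ_inv_apply)

universe u

variable {𝒢 : ProfiniteSemiGraph.{u}} (D : GaloisLevelData 𝒢) (h𝒢 : 𝒢.IsCountable)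

/-! ### The covering maps `𝒢_{∞,n+1} → 𝒢_{∞,n}` of the tower -/

/-- **The covering map `𝒢_{∞,n+1} → 𝒢_{∞,n}`** of the tower: the map induced by `S (n+1) → S n`,
followed by the change of base point `ḡ_n W_{n+1} = W_n`. [cite: MochizukiSemiAnbd2006, Prop 3.6 p.38] -/
noncomputable def stepCover (n : ℕ) : D.cover h𝒢 (n + 1) ⟶ D.cover h𝒢 n :=
  CovObj.projOver (D.g n) (D.W (n + 1)) h𝒢 ≫ (D.baseIso h𝒢 n).hom

/-- The descent square of the tower: `σ ≫ stepCover = stepCover ≫ step σ` for `σ ∈ Aut(𝒢_{∞,n+1})`.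
[cite: MochizukiSemiAnbd2006, Prop 3.6 p.38] -/
theorem hom_comp_stepCover (n : ℕ) (σ : D.Gal h𝒢 (n + 1)) :
    σ.hom ≫ D.stepCover h𝒢 n = D.stepCover h𝒢 n ≫ (D.step h𝒢 n σ).hom := by
  have hP := CovObj.hom_comp_projOver (D.g n) (D.W (n + 1)) h𝒢 (D.htrans n) σ
  have hstep : (D.step h𝒢 n σ).hom = (D.baseIso h𝒢 n).inv ≫
      (CovObj.descend (D.g n) (D.W (n + 1)) h𝒢 (D.htrans n) σ).hom ≫ (D.baseIso h𝒢 n).hom := by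
    change ((D.baseIso h𝒢 n).conjAut _).hom = _
    rw [Iso.conjAut_hom, Iso.conj_apply]
    rfl
  rw [hstep]
  exact calc σ.hom ≫ CovObj.projOver (D.g n) (D.W (n + 1)) h𝒢 ≫ (D.baseIso h𝒢 n).hom
      = (σ.hom ≫ CovObj.projOver (D.g n) (D.W (n + 1)) h𝒢) ≫ (D.baseIso h𝒢 n).hom :=
        (Category.assoc _ _ _).symm
    _ = (CovObj.projOver (D.g n) (D.W (n + 1)) h𝒢 ≫
          (CovObj.descend (D.g n) (D.W (n + 1)) h𝒢 (D.htrans n) σ).hom) ≫ (D.baseIso h𝒢 n).hom :=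
        congrArg (· ≫ (D.baseIso h𝒢 n).hom) hP
    _ = CovObj.projOver (D.g n) (D.W (n + 1)) h𝒢 ≫
          (CovObj.descend (D.g n) (D.W (n + 1)) h𝒢 (D.htrans n) σ).hom ≫ (D.baseIso h𝒢 n).hom :=
        Category.assoc _ _ _
    _ = CovObj.projOver (D.g n) (D.W (n + 1)) h𝒢 ≫ (D.baseIso h𝒢 n).hom ≫ (D.baseIso h𝒢 n).inv ≫
          (CovObj.descend (D.g n) (D.W (n + 1)) h𝒢 (D.htrans n) σ).hom ≫ (D.baseIso h𝒢 n).hom :=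
        congrArg (CovObj.projOver (D.g n) (D.W (n + 1)) h𝒢 ≫ ·)
          ((D.baseIso h𝒢 n).hom_inv_id_assoc _).symm
    _ = (CovObj.projOver (D.g n) (D.W (n + 1)) h𝒢 ≫ (D.baseIso h𝒢 n).hom) ≫ (D.baseIso h𝒢 n).inv ≫
          (CovObj.descend (D.g n) (D.W (n + 1)) h𝒢 (D.htrans n) σ).hom ≫ (D.baseIso h𝒢 n).hom :=
        (Category.assoc _ _ _).symm

/-- Pointwise form of the descent square. [cite: MochizukiSemiAnbd2006, Prop 3.6 p.38] -/
theorem stepCover_apply_aut (n : ℕ) (σ : D.Gal h𝒢 (n + 1)) {v : 𝒢.graph.Vertex}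
    (t : ((D.cover h𝒢 (n + 1)).SV v).obj.V) :
    ((D.stepCover h𝒢 n).fV v).hom.hom ((σ.hom.fV v).hom.hom t) =
      ((D.step h𝒢 n σ).hom.fV v).hom.hom (((D.stepCover h𝒢 n).fV v).hom.hom t) :=
  congrArg (fun φ : D.cover h𝒢 (n + 1) ⟶ D.cover h𝒢 n => (φ.fV v).hom.hom t) (D.hom_comp_stepCover h𝒢 n σ)

/-- The covering maps of the tower are `Π_v`-equivariant on fibres. [cite: MochizukiSemiAnbd2006, Prop 3.6 p.38] -/
theorem stepCover_ρ (n : ℕ) {v : 𝒢.graph.Vertex} (h : 𝒢.Gv v) (t : ((D.cover h𝒢 (n + 1)).SV v).obj.V) :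
    ((D.stepCover h𝒢 n).fV v).hom.hom (((D.cover h𝒢 (n + 1)).SV v).obj.ρ h t) =
      ((D.cover h𝒢 n).SV v).obj.ρ h (((D.stepCover h𝒢 n).fV v).hom.hom t) :=
  CovHom.fV_ρ (D.stepCover h𝒢 n) v h t

/-- On underlying semi-graphs, `stepCover` is the transition `treeStep` of the trees `𝔾̃_n` (under the
identifications `treeIso`). [cite: MochizukiSemiAnbd2006, Thm 3.7(iii) p.41] -/
theorem orbitGraphMap_stepCover (n : ℕ) :
    CovObj.orbitGraphMap (D.stepCover h𝒢 n) ≫ (D.treeIso h𝒢 n).hom =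
      (D.treeIso h𝒢 (n + 1)).hom ≫ D.treeStep n := by
  have e1 : CovObj.orbitGraphMap (D.baseIso h𝒢 n).hom ≫
      (D.S n).univCoverOverToUnivCover (Sum.inl (D.W n)) h𝒢 =
        (D.S n).univCoverOverToUnivCover (Sum.inl (CovObj.OVertex.map (D.g n) (D.W (n + 1)))) h𝒢 ≫
          eqToHom (congrArg (D.S n).orbitGraph.univCover (congrArg Sum.inl (D.hW n))) :=
    (D.S n).orbitGraphMap_eqToHom_comp_univCoverOverToUnivCover h𝒢 (congrArg Sum.inl (D.hW n))
  have e2 := CovObj.orbitGraphMap_univCoverOverMap_comp (D.g n) (Sum.inl (D.W (n + 1))) h𝒢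
  change CovObj.orbitGraphMap (CovObj.projOver (D.g n) (D.W (n + 1)) h𝒢 ≫ (D.baseIso h𝒢 n).hom) ≫
      (D.S n).univCoverOverToUnivCover (Sum.inl (D.W n)) h𝒢 =
    (D.S (n + 1)).univCoverOverToUnivCover (Sum.inl (D.W (n + 1))) h𝒢 ≫
      CovObj.treeMapV (D.g n) (D.W (n + 1)) ≫ eqToHom _
  rw [CovObj.orbitGraphMap_comp, Category.assoc, e1, ← Category.assoc]
  exact congrArg (· ≫ eqToHom (congrArg (D.S n).orbitGraph.univCover (congrArg Sum.inl (D.hW n)))) e2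

/-- Pointwise: the vertex of `𝔾̃_n` under the image of a point is the transition of the vertex under the
point. [cite: MochizukiSemiAnbd2006, Thm 3.7(iii) p.41] -/
theorem treeStep_vertexMap_mk (n : ℕ) {v : 𝒢.graph.Vertex} (t : ((D.cover h𝒢 (n + 1)).SV v).obj.V) :
    (D.treeStep n).vertexMap ((D.treeIso h𝒢 (n + 1)).hom.vertexMap (Quot.mk _ ⟨v, t⟩)) =
      (D.treeIso h𝒢 n).hom.vertexMap (Quot.mk _ ⟨v, ((D.stepCover h𝒢 n).fV v).hom.hom t⟩) := by
  have h := congrArg (fun φ => SemiGraph.Hom.vertexMap φ (Quot.mk _ ⟨v, t⟩)) (D.orbitGraphMap_stepCover h𝒢 n)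
  simp only [SemiGraph.comp_vertexMap, Function.comp_apply] at h
  exact h.symm

/-! ### Elements of `π₁^temp = lim_n Gal(𝒢_{∞,n}/𝒢)` from compatible sequences -/

/-- `mapLE` of a `step`-compatible sequence. [cite: MochizukiSemiAnbd2006, Prop 3.6 p.38] -/
theorem mapLE_of_step
    (σ : ∀ n, D.Gal h𝒢 n) (hσ : ∀ n, D.step h𝒢 n (σ (n + 1)) = σ n) {n m : ℕ} (h : n ≤ m) :
    D.mapLE h𝒢 h (σ m) = σ n := by
  induction m, h using Nat.le_induction with
  | base => rw [D.mapLE_self]; rfl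
  | succ k h ih => rw [D.mapLE_succ h𝒢 h, MonoidHom.comp_apply, hσ, ih]

/-- **An element of `π₁^temp(𝒢) = lim_n Gal(𝒢_{∞,n}/𝒢)` from a `step`-compatible sequence.**
[cite: MochizukiSemiAnbd2006, Prop 3.6(i) p.38] -/
noncomputable def mkPi
    (σ : ∀ n, D.Gal h𝒢 n) (hσ : ∀ n, D.step h𝒢 n (σ (n + 1)) = σ n) : D.temperedPi h𝒢 :=
  ⟨fun i => σ i.down, fun _ _ h => D.mapLE_of_step h𝒢 σ hσ h⟩

/-- The projections of `mkPi`. [cite: MochizukiSemiAnbd2006, Prop 3.6(i) p.38] -/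
theorem proj_mkPi
    (σ : ∀ n, D.Gal h𝒢 n) (hσ : ∀ n, D.step h𝒢 n (σ (n + 1)) = σ n) (n : ℕ) :
    D.proj h𝒢 n (D.mkPi h𝒢 σ hσ) = σ n := rfl

/-- Elements of `π₁^temp` are determined by their projections. [cite: MochizukiSemiAnbd2006, Prop 3.6(i) p.38] -/
theorem pi_ext
    {g g' : D.temperedPi h𝒢} (h : ∀ n, D.proj h𝒢 n g = D.proj h𝒢 n g') : g = g' :=
  Subtype.ext (funext fun i => h i.down)

/-- The action of `σ ∈ Aut(𝒢_{∞,n})` on a vertex of `𝔾̃_n` read through a point: `σ · [t] = [σ t]`.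
[cite: MochizukiSemiAnbd2006, Thm 3.7(iii) p.41] -/
theorem galTreeAct_vertexMap_mk (n : ℕ) (σ : D.Gal h𝒢 n) {v : 𝒢.graph.Vertex}
    (t : ((D.cover h𝒢 n).SV v).obj.V) :
    (D.galTreeAct h𝒢 n σ).hom.vertexMap ((D.treeIso h𝒢 n).hom.vertexMap (Quot.mk _ ⟨v, t⟩)) =
      (D.treeIso h𝒢 n).hom.vertexMap (Quot.mk _ ⟨v, (σ.hom.fV v).hom.hom t⟩) := by
  have h1 : (D.galTreeAct h𝒢 n σ).hom = (D.treeIso h𝒢 n).inv ≫ CovObj.orbitGraphMap σ.hom ≫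
      (D.treeIso h𝒢 n).hom := (D.S n).autUnivCover_hom (Sum.inl (D.W n)) h𝒢 σ
  have h2 : (D.treeIso h𝒢 n).inv.vertexMap ((D.treeIso h𝒢 n).hom.vertexMap (Quot.mk _ ⟨v, t⟩)) =
      Quot.mk _ ⟨v, t⟩ :=
    congrArg (fun φ : (D.cover h𝒢 n).orbitGraph ⟶ (D.cover h𝒢 n).orbitGraph =>
      φ.vertexMap (Quot.mk (D.cover h𝒢 n).VRel ⟨v, t⟩)) (D.treeIso h𝒢 n).hom_inv_id
  rw [h1]
  exact congrArg
    (fun V => (D.treeIso h𝒢 n).hom.vertexMap ((CovObj.orbitGraphMap σ.hom).vertexMap V)) h2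

/-! ### Compatible point sequences -/

/-- **A compatible sequence of points** of the fibres over `v` of the tower `𝒢_{∞,n}`:
`t n ∈ (𝒢_{∞,n})_v` with `stepCover (t (n+1)) = t n`. [cite: MochizukiSemiAnbd2006, Thm 3.7(iii) p.41] -/
structure PointSeq (v : 𝒢.graph.Vertex) : Type u where
  /-- the points -/
  pt : ∀ n : ℕ, ((D.cover h𝒢 n).SV v).obj.V
  /-- compatibility under the covering maps of the tower -/
  compat : ∀ n, ((D.stepCover h𝒢 n).fV v).hom.hom (pt (n + 1)) = pt n

namespace PointSeq

variable {D h𝒢} {v : 𝒢.graph.Vertex} (T : D.PointSeq h𝒢 v)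

/-- The vertex of the tree `𝔾̃_n` under the `n`-th point (its orbit, read in `𝔾̃_n`).
[cite: MochizukiSemiAnbd2006, Thm 3.7(iii) p.41] -/
noncomputable def vertex (n : ℕ) : (D.tree n).Vertex :=
  (D.treeIso h𝒢 n).hom.vertexMap (Quot.mk _ ⟨v, T.pt n⟩)

/-- The vertices under a compatible point sequence form a compatible vertex system of the trees.
[cite: MochizukiSemiAnbd2006, Thm 3.7(iii) p.41] -/
theorem treeStep_vertex (n : ℕ) : (D.treeStep n).vertexMap (T.vertex (n + 1)) = T.vertex n := by
  unfold vertex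
  rw [D.treeStep_vertexMap_mk h𝒢 n, T.compat n]

/-- Compatibility of the vertex system for all `i ≤ j`. [cite: MochizukiSemiAnbd2006, Thm 3.7(iii) p.41] -/
theorem treeTrans_vertex {i j : ℕ} (h : i ≤ j) : (D.treeTrans h).vertexMap (T.vertex j) = T.vertex i := by
  induction j, h using Nat.le_induction with
  | base => rw [D.treeTrans_self]; rfl
  | succ k h ih => rw [D.treeTrans_succ h, SemiGraph.comp_vertexMap, Function.comp_apply, T.treeStep_vertex, ih]

/-! ### The automorphisms `σ_n^h` -/

/-- For `h ∈ Π_v`: the automorphism of `𝒢_{∞,n}` moving `t n` to `h⁻¹ · t n` (a choice; unique by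
rigidity). [cite: MochizukiSemiAnbd2006, Thm 3.7(i) p.40] -/
noncomputable def gal (n : ℕ) (h : 𝒢.Gv v) : D.Gal h𝒢 n :=
  ((D.S n).exists_aut_apply_eq' h𝒢 (D.W n) (D.htrans n) (T.pt n)
    (((D.cover h𝒢 n).SV v).obj.ρ h⁻¹ (T.pt n))).choose

/-- The defining property of `σ_n^h`. [cite: MochizukiSemiAnbd2006, Thm 3.7(i) p.40] -/
theorem gal_apply (n : ℕ) (h : 𝒢.Gv v) :
    ((T.gal n h).hom.fV v).hom.hom (T.pt n) = ((D.cover h𝒢 n).SV v).obj.ρ h⁻¹ (T.pt n) :=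
  ((D.S n).exists_aut_apply_eq' h𝒢 (D.W n) (D.htrans n) (T.pt n)
    (((D.cover h𝒢 n).SV v).obj.ρ h⁻¹ (T.pt n))).choose_spec

/-- Uniqueness: an automorphism of `𝒢_{∞,n}` moving `t n` to `h⁻¹ · t n` is `σ_n^h` (rigidity of
`𝒢_{∞,n}`). [cite: MochizukiSemiAnbd2006, Thm 3.7(i) p.40] -/
theorem eq_gal (n : ℕ) (h : 𝒢.Gv v) (η : D.Gal h𝒢 n)
    (hη : (η.hom.fV v).hom.hom (T.pt n) = ((D.cover h𝒢 n).SV v).obj.ρ h⁻¹ (T.pt n)) : η = T.gal n h :=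
  Iso.ext ((D.S n).univCoverOver_hom_ext (Sum.inl (D.W n)) h𝒢 _ _ (T.pt n) (hη.trans (T.gal_apply n h).symm))

/-- `σ_n^1 = 1`. [cite: MochizukiSemiAnbd2006, Thm 3.7(i) p.40] -/
theorem gal_one (n : ℕ) : T.gal n 1 = 1 :=
  (T.eq_gal n 1 1 (by rw [inv_one, ρ_one_apply]; rfl)).symm

/-- `σ_n^{hh'} = σ_n^h σ_n^{h'}`. [cite: MochizukiSemiAnbd2006, Thm 3.7(i) p.40] -/
theorem gal_mul (n : ℕ) (h h' : 𝒢.Gv v) : T.gal n (h * h') = T.gal n h * T.gal n h' := by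
  symm
  apply T.eq_gal
  change ((T.gal n h).hom.fV v).hom.hom (((T.gal n h').hom.fV v).hom.hom (T.pt n)) = _
  rw [T.gal_apply n h', CovHom.fV_ρ, T.gal_apply n h, ← ρ_mul_apply, mul_inv_rev]

/-- Compatibility with the transition homomorphisms: `step (σ_{n+1}^h) = σ_n^h`.
[cite: MochizukiSemiAnbd2006, Prop 3.6 p.38] -/
theorem step_gal (n : ℕ) (h : 𝒢.Gv v) : D.step h𝒢 n (T.gal (n + 1) h) = T.gal n h := by
  apply T.eq_gal
  rw [← T.compat n, ← D.stepCover_apply_aut h𝒢 n, T.gal_apply (n + 1) h, D.stepCover_ρ h𝒢 n]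

/-! ### The decomposition homomorphism -/

/-- **The decomposition homomorphism `Π_v → π₁^temp(𝒢)` at the compatible point sequence `t`**:
`h ↦ (σ_n^h)_n`. [cite: MochizukiSemiAnbd2006, Thm 3.7(i) p.40] -/
noncomputable def decompHom : 𝒢.Gv v →* D.temperedPi h𝒢 where
  toFun h := D.mkPi h𝒢 (fun n => T.gal n h) (fun n => T.step_gal n h)
  map_one' := D.pi_ext h𝒢 fun n => by
    rw [D.proj_mkPi h𝒢, map_one]
    exact T.gal_one n
  map_mul' h h' := D.pi_ext h𝒢 fun n => by
    rw [D.proj_mkPi h𝒢, map_mul, D.proj_mkPi h𝒢, D.proj_mkPi h𝒢]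
    exact T.gal_mul n h h'

/-- The projections of the decomposition homomorphism. [cite: MochizukiSemiAnbd2006, Thm 3.7(i) p.40] -/
theorem proj_decompHom (n : ℕ) (h : 𝒢.Gv v) : D.proj h𝒢 n ((T.decompHom) h) = T.gal n h := rfl

/-- The defining property of the decomposition homomorphism on the point sequence: the `n`-th component of
`decompHom h` moves `t n` to `h⁻¹ · t n`. [cite: MochizukiSemiAnbd2006, Thm 3.7(i) p.40] -/
theorem proj_decompHom_apply (n : ℕ) (h : 𝒢.Gv v) :
    (((D.proj h𝒢 n ((T.decompHom) h)).hom.fV v).hom.hom (T.pt n)) =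
      ((D.cover h𝒢 n).SV v).obj.ρ h⁻¹ (T.pt n) :=
  T.gal_apply n h

/-- Characterisation: `g = decompHom h` iff every component of `g` moves `t n` to `h⁻¹ · t n`.
[cite: MochizukiSemiAnbd2006, Thm 3.7(i) p.40] -/
theorem eq_decompHom (g : D.temperedPi h𝒢) (h : 𝒢.Gv v)
    (hg : ∀ n, (((D.proj h𝒢 n g).hom.fV v).hom.hom (T.pt n)) = ((D.cover h𝒢 n).SV v).obj.ρ h⁻¹ (T.pt n)) :
    g = (T.decompHom) h :=
  D.pi_ext h𝒢 fun n => T.eq_gal n h _ (hg n)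

/-- The kernel of the `n`-th component `h ↦ σ_n^h` is the stabiliser of `t n` in `Π_v`.
[cite: MochizukiSemiAnbd2006, Thm 3.7(i) p.40] -/
theorem gal_eq_one_iff (n : ℕ) (h : 𝒢.Gv v) :
    T.gal n h = 1 ↔ ((D.cover h𝒢 n).SV v).obj.ρ h (T.pt n) = T.pt n := by
  constructor
  · intro h1
    have h2 := T.gal_apply n h
    rw [h1] at h2
    change T.pt n = _ at h2
    have h3 := congrArg (((D.cover h𝒢 n).SV v).obj.ρ h) h2
    rw [← ρ_mul_apply, mul_inv_cancel, ρ_one_apply] at h3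
    exact h3
  · intro h1
    symm
    apply T.eq_gal
    change T.pt n = _
    calc T.pt n = ((D.cover h𝒢 n).SV v).obj.ρ h⁻¹ (((D.cover h𝒢 n).SV v).obj.ρ h (T.pt n)) :=
        (ρ_inv_apply _ h _).symm
      _ = ((D.cover h𝒢 n).SV v).obj.ρ h⁻¹ (T.pt n) := by rw [h1]

/-- **The decomposition homomorphism is continuous** (the kernel of each component is the open stabiliser
of `t n`). [cite: MochizukiSemiAnbd2006, Thm 3.7(i) p.40] -/
theorem continuous_decompHom : Continuous T.decompHom := by
  refine continuous_induced_rng.2 (continuous_pi fun i => ?_)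
  obtain ⟨n⟩ := i
  change Continuous fun h => T.gal n h
  refine continuous_discrete_rng.2 fun b => ?_
  by_cases hb : ∃ h₀, T.gal n h₀ = b
  · obtain ⟨h₀, rfl⟩ := hb
    have hset : (fun h => T.gal n h) ⁻¹' {T.gal n h₀} =
        (fun h => h₀⁻¹ * h) ⁻¹' (stabilizerSubgroup ((D.cover h𝒢 n).SV v) (T.pt n) : Set (𝒢.Gv v)) := by
      ext h
      simp only [Set.mem_preimage, Set.mem_singleton_iff, SetLike.mem_coe, mem_stabilizerSubgroup_iff]
      rw [← T.gal_eq_one_iff]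
      change ((D.proj h𝒢 n).comp T.decompHom) h = ((D.proj h𝒢 n).comp T.decompHom) h₀ ↔
        ((D.proj h𝒢 n).comp T.decompHom) (h₀⁻¹ * h) = 1
      rw [map_mul, map_inv, inv_mul_eq_one, eq_comm]
    rw [hset]
    exact (isOpen_stabilizerSubgroup _ _).preimage (continuous_const.mul continuous_id)
  · have hset : (fun h => T.gal n h) ⁻¹' {b} = ∅ :=
      Set.eq_empty_iff_forall_notMem.mpr fun h hh => hb ⟨h, hh⟩
    rw [hset]
    exact isOpen_empty

/-- **The decomposition homomorphism as a continuous homomorphism `Π_v →ₜ* π₁^temp(𝒢)`.**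
[cite: MochizukiSemiAnbd2006, Thm 3.7(i) p.40] -/
noncomputable def decompHomCont : 𝒢.Gv v →ₜ* D.temperedPi h𝒢 :=
  ⟨T.decompHom, T.continuous_decompHom⟩

/-- `decompHomCont` is `decompHom`. [cite: MochizukiSemiAnbd2006, Thm 3.7(i) p.40] -/
theorem decompHomCont_toMonoidHom : T.decompHomCont.toMonoidHom = T.decompHom := rfl

/-! ### (I1), tree half: the image of `Π_v` fixes the vertex system -/

/-- **(I1), tree half**: the image of `Π_v` under the decomposition homomorphism FIXES the compatible
vertex system `x n = [t n]` of the trees (`h⁻¹ · t n` has the same orbit as `t n`).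
[cite: MochizukiSemiAnbd2006, Thm 3.7(iii) p.41] -/
theorem treeAct_decompHom_vertexMap (n : ℕ) (h : 𝒢.Gv v) :
    (D.treeAct h𝒢 n ((T.decompHom) h)).hom.vertexMap (T.vertex n) = T.vertex n := by
  rw [D.treeAct_apply, T.proj_decompHom]
  unfold vertex
  rw [D.galTreeAct_vertexMap_mk h𝒢 n (T.gal n h) (T.pt n), T.gal_apply]
  exact congrArg _ (Quot.sound (CovObj.VRel.mk (S := D.cover h𝒢 n) v h⁻¹ (T.pt n))).symm

end PointSeq

end GaloisLevelData

end ProfiniteSemiGraph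

end Literature.AnabelianGeometry.SemiGraphs
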